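import Summits.Parity.BatemanHorn.Theorems.AlmostPrimeZerosDiscMajorantLogFixedDiscX
import Literature.NumberTheory.Transcendental.LWMeasureMainPropArith
import HarnessLib

/-!
# Crux `DiscMajorantLog` (stmt-Parity-17114), line `Sketch`: calibration — the cell `k = 1`,
`f = X + c` (every monic degree-1 system) on every FIXED disc

Support lemma for the crux `Summit.Parity.BatemanHorn.Theses.AlmostPrimeZeros.DiscMajorantLog`
(line `Sketch`), stub `stub_fixedDiscXAdd`.  The landed cell `stub_fixedDiscX` gives, for the system
`f = (X)` and every radius `R₀`, the Γ-budget majorant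
`‖P_y(z)‖ ≤ A·y·(log y)^{Re z − 1}·exp(C‖z−1‖ log(‖z−1‖+2))`, `P_y(z) := Σ_{0≤m≤y} z^{s(m)}`,
`s(m) = Σ_{p^v ∥ m} min(v,2)`, for `y ≥ x₁` and `‖z − 1‖ ≤ R₀`.  This file transports it to every
monic linear system `f = (X + c)`, `c : ℤ`, by pure bookkeeping: the crux exponent at `n` is
`s(((n : ℤ) + c).toNat)`, so

* for `c = d ≥ 0`: `S_x(z) = Σ_{n≤x} z^{s(n+d)} = P_{x+d}(z) − Σ_{m<d} z^{s(m)}`;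
* for `c = −d ≤ 0`: `S_x(z) = d + P_{x−d}(z)` (`Int.toNat` truncates, `s(0) = 0`).

On a FIXED disc the condition `‖z − 1‖ ≤ R₀` is the same at `x` and at `x ± d`, and
`(log(x ± d))^{t} ≤ 2^{R₀+1}(log x)^{t}` for `|t| ≤ R₀ + 1` once `x ≥ 2d + 4`; the additive constants
are absorbed by `x·(log x)^{t} ≥ x·(log x)^{−(R₀+1)} ≥ 1` for large `x`
(`(log x)^{R₀+1} = o(x)`).  Reference for the cell itself: H. L. Montgomery, R. C. Vaughan,
*Multiplicative Number Theory I*, CUP 2007, §7.4 (Theorems 7.17–7.18).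
-/

noncomputable section

namespace Summit.Parity.BatemanHorn.Cruxes.DiscMajorantLog.Sketch

open Polynomial Finset
open Literature.NumberTheory.Transcendental.LWMeasure (one_le_log_of_three_le)

namespace FixedDiscXAdd

/-- For the system `f = (X + C c)` the crux's exponent `Σ_i Σ_{p^v ∥ f_i(n)} min(v,2)` at `n` is the
capped statistic `s` of the natural number `((n : ℤ) + c).toNat`. [folklore] -/
theorem exponent_XAdd (c : ℤ) (n : ℕ) :
    (∑ i : Fin 1, ((((![X + C c] : Fin 1 → ℤ[X]) i).eval (n : ℤ)).toNat.factorization.sum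
      fun _ v => min v 2)) = (((n : ℤ) + c).toNat).factorization.sum fun _ v => min v 2 := by
  simp [Matrix.cons_val_fin_one, eval_add, eval_X]

/-- Index shift by a natural number `d`: `Σ_{n≤x} z^{g(n+d)} = Σ_{m≤x+d} z^{g m} − Σ_{m<d} z^{g m}`.
[folklore] -/
theorem sum_shift_natCast (z : ℂ) (g : ℕ → ℕ) (x d : ℕ) :
    ∑ n ∈ range (x + 1), z ^ g (((n : ℤ) + (d : ℤ)).toNat) =
      ∑ m ∈ range (x + d + 1), z ^ g m - ∑ m ∈ range d, z ^ g m := by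
  have h : ∀ n : ℕ, ((n : ℤ) + (d : ℤ)).toNat = d + n := fun n => by
    have : (n : ℤ) + (d : ℤ) = ((d + n : ℕ) : ℤ) := by push_cast; ring
    rw [this, Int.toNat_natCast]
  simp_rw [h]
  rw [show x + d + 1 = d + (x + 1) by ring, Finset.sum_range_add _ d (x + 1), add_sub_cancel_left]

/-- Index shift by `−d`, `d` a natural number, `d ≤ x`: the truncation `Int.toNat` sends the first
`d` terms to `z^{g 0} = 1`, so `Σ_{n≤x} z^{g((n−d)⁺)} = d + Σ_{m≤x−d} z^{g m}`. [folklore] -/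
theorem sum_shift_neg (z : ℂ) (g : ℕ → ℕ) (hg : g 0 = 0) {x d : ℕ} (h : d ≤ x) :
    ∑ n ∈ range (x + 1), z ^ g (((n : ℤ) + -(d : ℤ)).toNat) =
      (d : ℂ) + ∑ m ∈ range (x - d + 1), z ^ g m := by
  have h1 : ∀ n : ℕ, ((n : ℤ) + -(d : ℤ)).toNat = n - d := fun n => by
    rw [← sub_eq_add_neg, Int.toNat_sub]
  simp_rw [h1]
  rw [show x + 1 = d + (x - d + 1) by omega, Finset.sum_range_add]
  congr 1
  · rw [Finset.sum_eq_card_nsmul (b := (1 : ℂ)) fun n hn => ?_]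
    · simp
    · rw [Nat.sub_eq_zero_of_le (Finset.mem_range.1 hn).le, hg, pow_zero]
  · exact Finset.sum_congr rfl fun m _ => by rw [Nat.add_sub_cancel_left]

/-- The first `d` terms are bounded by a constant depending only on `d` and the disc:
`‖Σ_{m<d} z^{g m}‖ ≤ Σ_{m<d} B^{g m}` whenever `‖z‖ ≤ B`. [folklore] -/
theorem norm_sum_pow_le (z : ℂ) (g : ℕ → ℕ) (d : ℕ) {B : ℝ} (hz : ‖z‖ ≤ B) :
    ‖∑ m ∈ range d, z ^ g m‖ ≤ ∑ m ∈ range d, B ^ g m :=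
  (norm_sum_le _ _).trans (Finset.sum_le_sum fun m _ => by
    rw [norm_pow]; exact pow_le_pow_left₀ (norm_nonneg _) hz _)

/-- On the disc `‖z − 1‖ ≤ R` one has `‖z‖ ≤ R + 1`. [folklore] -/
theorem norm_le_of_mem_disc {z : ℂ} {R : ℝ} (hz : ‖z - 1‖ ≤ R) : ‖z‖ ≤ R + 1 := by
  calc ‖z‖ = ‖(z - 1) + 1‖ := by rw [sub_add_cancel]
    _ ≤ ‖z - 1‖ + ‖(1 : ℂ)‖ := norm_add_le _ _
    _ ≤ R + 1 := by rw [norm_one]; linarith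

/-- On the disc `‖z − 1‖ ≤ R` the exponent `t = Re z − 1` satisfies `|t| ≤ R + 1`. [folklore] -/
theorem re_sub_one_mem {z : ℂ} {R : ℝ} (hz : ‖z - 1‖ ≤ R) :
    -(R + 1) ≤ z.re - 1 ∧ z.re - 1 ≤ R + 1 := by
  have h : |z.re - 1| ≤ ‖z - 1‖ := by
    simpa [Complex.sub_re, Complex.one_re] using Complex.abs_re_le_norm (z - 1)
  rw [abs_le] at h
  constructor <;> linarith

/-- Two-sided `rpow` comparison: if `L, L' > 0` are within a factor `2` of each other and
`|t| ≤ R + 1`, then `L'^t ≤ 2^{R+1}·L^t`. [folklore] -/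
theorem rpow_le_two_rpow_mul {L L' t R : ℝ} (hL : 0 < L) (hL' : 0 < L') (h1 : L' ≤ 2 * L)
    (h2 : L ≤ 2 * L') (ht1 : -(R + 1) ≤ t) (ht2 : t ≤ R + 1) :
    L' ^ t ≤ (2 : ℝ) ^ (R + 1) * L ^ t := by
  have hLt : 0 ≤ L ^ t := Real.rpow_nonneg hL.le t
  rcases le_or_gt 0 t with ht | ht
  · calc L' ^ t ≤ (2 * L) ^ t := Real.rpow_le_rpow hL'.le h1 ht
      _ = (2 : ℝ) ^ t * L ^ t := Real.mul_rpow (by norm_num) hL.le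
      _ ≤ (2 : ℝ) ^ (R + 1) * L ^ t :=
        mul_le_mul_of_nonneg_right (Real.rpow_le_rpow_of_exponent_le (by norm_num) ht2) hLt
  · have h3 : (2 * L') ^ t ≤ L ^ t := Real.rpow_le_rpow_of_nonpos hL h2 ht.le
    rw [Real.mul_rpow (by norm_num) hL'.le] at h3
    have h4 : L' ^ t = (2 : ℝ) ^ (-t) * ((2 : ℝ) ^ t * L' ^ t) := by
      rw [← mul_assoc, ← Real.rpow_add (by norm_num), neg_add_cancel, Real.rpow_zero, one_mul]
    rw [h4]
    calc (2 : ℝ) ^ (-t) * ((2 : ℝ) ^ t * L' ^ t) ≤ (2 : ℝ) ^ (-t) * L ^ t :=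
          mul_le_mul_of_nonneg_left h3 (Real.rpow_nonneg (by norm_num) _)
      _ ≤ (2 : ℝ) ^ (R + 1) * L ^ t :=
          mul_le_mul_of_nonneg_right
            (Real.rpow_le_rpow_of_exponent_le (by norm_num) (by linarith)) hLt

/-- Absorbing additive constants: `x·(log x)^t ≥ 1` for all `t ≥ −(R+1)` once `x` is large
(`(log x)^{R+1} = o(x)`). [folklore] -/
theorem one_le_mul_log_rpow (R : ℝ) : ∃ x₂ : ℕ, ∀ x : ℕ, x₂ ≤ x → ∀ t : ℝ, -(R + 1) ≤ t →
    1 ≤ (x : ℝ) * Real.log (x : ℝ) ^ t := by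
  have ho := (isLittleO_log_rpow_rpow_atTop (R + 1) one_pos).def one_pos
  obtain ⟨a, ha⟩ := Filter.eventually_atTop.1 ho
  refine ⟨max ⌈a⌉₊ 3, fun x hx t ht => ?_⟩
  have hxa : a ≤ x := (Nat.le_ceil a).trans (by exact_mod_cast (le_max_left _ _).trans hx)
  have hx3 : (3 : ℝ) ≤ x := by exact_mod_cast (le_max_right _ _).trans hx
  have hlog : 1 ≤ Real.log (x : ℝ) := one_le_log_of_three_le ((le_max_right _ _).trans hx)
  have h1 := ha x hxa
  rw [one_mul, Real.rpow_one, Real.norm_of_nonneg (Real.rpow_nonneg (by linarith) _),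
    Real.norm_of_nonneg (by linarith)] at h1
  have hpos : 0 < Real.log (x : ℝ) ^ (R + 1) := Real.rpow_pos_of_pos (by linarith) _
  calc (1 : ℝ) ≤ x * Real.log (x : ℝ) ^ (-(R + 1)) := by
        rw [Real.rpow_neg (by linarith), ← div_eq_mul_inv, one_le_div hpos]; exact h1
    _ ≤ x * Real.log (x : ℝ) ^ t :=
        mul_le_mul_of_nonneg_left (Real.rpow_le_rpow_of_exponent_le hlog ht) (by linarith)

/-- The landed `f = X` cell in plain form, with nonnegative constants: for every `R₀` there are
`A, C ≥ 0` and `x₁` with `‖Σ_{m≤y} z^{s(m)}‖ ≤ A·y·(log y)^{Re z−1}·exp(C‖z−1‖ log(‖z−1‖+2))` for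
`y ≥ x₁`, `‖z − 1‖ ≤ R₀`. [cite: MontgomeryVaughan2007, §7.4 Theorems 7.17–7.18] -/
theorem cell (R₀ : ℝ) : ∃ A C : ℝ, 0 ≤ A ∧ 0 ≤ C ∧ ∃ x₁ : ℕ, ∀ y : ℕ, x₁ ≤ y → ∀ z : ℂ,
    ‖z - 1‖ ≤ R₀ → ‖∑ m ∈ range (y + 1), z ^ (m.factorization.sum fun _ v => min v 2)‖ ≤
      A * (y : ℝ) * Real.log (y : ℝ) ^ (z.re - 1) *
        Real.exp (C * ‖z - 1‖ * Real.log (‖z - 1‖ + 2)) := by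
  obtain ⟨A, C, x₁, h⟩ := stub_fixedDiscX R₀
  refine ⟨max A 0, max C 0, le_max_right _ _, le_max_right _ _, x₁, fun y hy z hz => ?_⟩
  have h0 := h y hy z hz
  simp_rw [FixedDiscX.exponent_X, Nat.cast_one, one_mul] at h0
  refine h0.trans ?_
  have h1 : 0 ≤ (y : ℝ) * Real.log (y : ℝ) ^ (z.re - 1) :=
    mul_nonneg (Nat.cast_nonneg _) (Real.rpow_nonneg (Real.log_natCast_nonneg y) _)
  have h2 : 0 ≤ ‖z - 1‖ * Real.log (‖z - 1‖ + 2) :=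
    mul_nonneg (norm_nonneg _) (Real.log_nonneg (by linarith [norm_nonneg (z - 1)]))
  have h3 : Real.exp (C * ‖z - 1‖ * Real.log (‖z - 1‖ + 2)) ≤
      Real.exp (max C 0 * ‖z - 1‖ * Real.log (‖z - 1‖ + 2)) := by
    rw [Real.exp_le_exp, mul_assoc, mul_assoc]
    exact mul_le_mul_of_nonneg_right (le_max_left _ _) h2
  calc A * y * Real.log (y : ℝ) ^ (z.re - 1) * Real.exp (C * ‖z - 1‖ * Real.log (‖z - 1‖ + 2))
      = A * (y * Real.log (y : ℝ) ^ (z.re - 1)) *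
          Real.exp (C * ‖z - 1‖ * Real.log (‖z - 1‖ + 2)) := by ring
    _ ≤ max A 0 * (y * Real.log (y : ℝ) ^ (z.re - 1)) *
          Real.exp (max C 0 * ‖z - 1‖ * Real.log (‖z - 1‖ + 2)) :=
        mul_le_mul (mul_le_mul_of_nonneg_right (le_max_left _ _) h1) h3 (Real.exp_pos _).le
          (mul_nonneg (le_max_right _ _) h1)
    _ = _ := by ring

/-- Reduction, case `c = d ≥ 0`: from a plain cell for `Σ_{m≤y} z^{g m}` on the disc `‖z − 1‖ ≤ R`
to the same bound (same `C`) for the shifted sum `Σ_{n≤x} z^{g(n+d)}`. [folklore] -/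
theorem case_natCast (g : ℕ → ℕ) {R A₁ C₁ : ℝ} (hR : 0 ≤ R) (hA : 0 ≤ A₁) (hC : 0 ≤ C₁) {x₁ : ℕ}
    (hcell : ∀ y : ℕ, x₁ ≤ y → ∀ z : ℂ, ‖z - 1‖ ≤ R → ‖∑ m ∈ range (y + 1), z ^ g m‖ ≤
      A₁ * (y : ℝ) * Real.log (y : ℝ) ^ (z.re - 1) *
        Real.exp (C₁ * ‖z - 1‖ * Real.log (‖z - 1‖ + 2)))
    (d : ℕ) : ∃ A : ℝ, ∃ x₀ : ℕ, ∀ x : ℕ, x₀ ≤ x → ∀ z : ℂ, ‖z - 1‖ ≤ R →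
      ‖∑ n ∈ range (x + 1), z ^ g (((n : ℤ) + (d : ℤ)).toNat)‖ ≤
        A * (x : ℝ) * Real.log (x : ℝ) ^ (z.re - 1) *
          Real.exp (C₁ * ‖z - 1‖ * Real.log (‖z - 1‖ + 2)) := by
  obtain ⟨x₂, hx₂⟩ := one_le_mul_log_rpow R
  set K : ℝ := ∑ m ∈ range d, (R + 1) ^ g m with hK
  have hK0 : 0 ≤ K := Finset.sum_nonneg fun m _ => pow_nonneg (by linarith) _
  refine ⟨2 * (2 : ℝ) ^ (R + 1) * A₁ + K, x₁ + x₂ + d + 3, fun x hx z hz => ?_⟩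
  have hxd : d ≤ x := by omega
  have hx3 : (3 : ℝ) ≤ x := by exact_mod_cast (show 3 ≤ x by omega)
  have hx0 : (0 : ℝ) < x := by linarith
  have hdx : (d : ℝ) ≤ x := by exact_mod_cast hxd
  have hlog1 : 1 ≤ Real.log (x : ℝ) := one_le_log_of_three_le (by omega)
  have hlog0 : 0 < Real.log (x : ℝ) := by linarith
  obtain ⟨ht1, ht2⟩ := re_sub_one_mem hz
  set t : ℝ := z.re - 1 with ht
  set E : ℝ := Real.exp (C₁ * ‖z - 1‖ * Real.log (‖z - 1‖ + 2)) with hE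
  have hE1 : 1 ≤ E := Real.one_le_exp (mul_nonneg (mul_nonneg hC (norm_nonneg _))
    (Real.log_nonneg (by linarith [norm_nonneg (z - 1)])))
  have hLt : 0 ≤ Real.log (x : ℝ) ^ t := Real.rpow_nonneg hlog0.le t
  have hone : 1 ≤ (x : ℝ) * Real.log (x : ℝ) ^ t * E :=
    one_le_mul_of_one_le_of_one_le (hx₂ x (by omega) t ht1) hE1
  rw [sum_shift_natCast z g x d]
  -- the short block
  have hsmall : ‖∑ m ∈ range d, z ^ g m‖ ≤ K :=
    norm_sum_pow_le z g d (norm_le_of_mem_disc hz)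
  -- the long block: the cell at `y = x + d`
  have hxd' : ((x + d : ℕ) : ℝ) = (x : ℝ) + d := by push_cast; ring
  have hlogd : Real.log (x : ℝ) ≤ Real.log ((x : ℝ) + d) :=
    Real.log_le_log hx0 (by linarith [(Nat.cast_nonneg d : (0 : ℝ) ≤ d)])
  have hcmp : Real.log ((x : ℝ) + d) ^ t ≤ (2 : ℝ) ^ (R + 1) * Real.log (x : ℝ) ^ t := by
    refine rpow_le_two_rpow_mul hlog0 (hlog0.trans_le hlogd) ?_ (by linarith) ht1 ht2
    calc Real.log ((x : ℝ) + d) ≤ Real.log (2 * x) := Real.log_le_log (by linarith) (by linarith)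
      _ = Real.log 2 + Real.log x := Real.log_mul (by norm_num) hx0.ne'
      _ ≤ 2 * Real.log x := by
          have : Real.log 2 ≤ Real.log x := Real.log_le_log (by norm_num) (by linarith)
          linarith
  have hbig : ‖∑ m ∈ range (x + d + 1), z ^ g m‖ ≤
      2 * (2 : ℝ) ^ (R + 1) * A₁ * x * Real.log (x : ℝ) ^ t * E := by
    refine (hcell (x + d) (by omega) z hz).trans ?_
    rw [hxd']
    calc A₁ * ((x : ℝ) + d) * Real.log ((x : ℝ) + d) ^ t * E
        = A₁ * (((x : ℝ) + d) * Real.log ((x : ℝ) + d) ^ t) * E := by ring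
      _ ≤ A₁ * ((2 * x) * ((2 : ℝ) ^ (R + 1) * Real.log (x : ℝ) ^ t)) * E := by
          refine mul_le_mul_of_nonneg_right (mul_le_mul_of_nonneg_left ?_ hA) (by positivity)
          exact mul_le_mul (by linarith) hcmp (Real.rpow_nonneg (hlog0.le.trans hlogd) t)
            (by positivity)
      _ = 2 * (2 : ℝ) ^ (R + 1) * A₁ * x * Real.log (x : ℝ) ^ t * E := by ring
  calc ‖∑ m ∈ range (x + d + 1), z ^ g m - ∑ m ∈ range d, z ^ g m‖
      ≤ ‖∑ m ∈ range (x + d + 1), z ^ g m‖ + ‖∑ m ∈ range d, z ^ g m‖ := norm_sub_le _ _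
    _ ≤ 2 * (2 : ℝ) ^ (R + 1) * A₁ * x * Real.log (x : ℝ) ^ t * E + K := add_le_add hbig hsmall
    _ ≤ 2 * (2 : ℝ) ^ (R + 1) * A₁ * x * Real.log (x : ℝ) ^ t * E +
          K * ((x : ℝ) * Real.log (x : ℝ) ^ t * E) :=
        add_le_add le_rfl (le_mul_of_one_le_right hK0 hone)
    _ = (2 * (2 : ℝ) ^ (R + 1) * A₁ + K) * x * Real.log (x : ℝ) ^ t * E := by ring

/-- Reduction, case `c = −d ≤ 0`: from a plain cell for `Σ_{m≤y} z^{g m}` (`g 0 = 0`) on the disc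
`‖z − 1‖ ≤ R` to the same bound (same `C`) for `Σ_{n≤x} z^{g((n−d)⁺)}`. [folklore] -/
theorem case_neg (g : ℕ → ℕ) (hg : g 0 = 0) {R A₁ C₁ : ℝ} (hA : 0 ≤ A₁) (hC : 0 ≤ C₁) {x₁ : ℕ}
    (hcell : ∀ y : ℕ, x₁ ≤ y → ∀ z : ℂ, ‖z - 1‖ ≤ R → ‖∑ m ∈ range (y + 1), z ^ g m‖ ≤
      A₁ * (y : ℝ) * Real.log (y : ℝ) ^ (z.re - 1) *
        Real.exp (C₁ * ‖z - 1‖ * Real.log (‖z - 1‖ + 2)))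
    (d : ℕ) : ∃ A : ℝ, ∃ x₀ : ℕ, ∀ x : ℕ, x₀ ≤ x → ∀ z : ℂ, ‖z - 1‖ ≤ R →
      ‖∑ n ∈ range (x + 1), z ^ g (((n : ℤ) + -(d : ℤ)).toNat)‖ ≤
        A * (x : ℝ) * Real.log (x : ℝ) ^ (z.re - 1) *
          Real.exp (C₁ * ‖z - 1‖ * Real.log (‖z - 1‖ + 2)) := by
  obtain ⟨x₂, hx₂⟩ := one_le_mul_log_rpow R
  refine ⟨(2 : ℝ) ^ (R + 1) * A₁ + d, x₁ + x₂ + 2 * d + 4, fun x hx z hz => ?_⟩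
  have hxd : d ≤ x := by omega
  have hx4 : (4 : ℝ) ≤ x := by exact_mod_cast (show 4 ≤ x by omega)
  have hx0 : (0 : ℝ) < x := by linarith
  have hdx : 2 * (d : ℝ) ≤ x := by exact_mod_cast (show 2 * d ≤ x by omega)
  have hlog1 : 1 ≤ Real.log (x : ℝ) := one_le_log_of_three_le (by omega)
  have hlog0 : 0 < Real.log (x : ℝ) := by linarith
  obtain ⟨ht1, ht2⟩ := re_sub_one_mem hz
  set t : ℝ := z.re - 1 with ht
  set E : ℝ := Real.exp (C₁ * ‖z - 1‖ * Real.log (‖z - 1‖ + 2)) with hE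
  have hE1 : 1 ≤ E := Real.one_le_exp (mul_nonneg (mul_nonneg hC (norm_nonneg _))
    (Real.log_nonneg (by linarith [norm_nonneg (z - 1)])))
  have hLt : 0 ≤ Real.log (x : ℝ) ^ t := Real.rpow_nonneg hlog0.le t
  have hone : 1 ≤ (x : ℝ) * Real.log (x : ℝ) ^ t * E :=
    one_le_mul_of_one_le_of_one_le (hx₂ x (by omega) t ht1) hE1
  rw [sum_shift_neg z g hg hxd]
  -- the long block: the cell at `y = x - d`
  have hy2 : (2 : ℝ) ≤ (x : ℝ) - d := by linarith
  have hlogy : 0 < Real.log ((x : ℝ) - d) := Real.log_pos (by linarith)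
  have hlogle : Real.log ((x : ℝ) - d) ≤ Real.log x :=
    Real.log_le_log (by linarith) (by linarith [(Nat.cast_nonneg d : (0 : ℝ) ≤ d)])
  have hcmp1 : Real.log ((x : ℝ) - d) ≤ 2 * Real.log x := by linarith
  have hcmp2 : Real.log (x : ℝ) ≤ 2 * Real.log ((x : ℝ) - d) := by
    have h1 : Real.log (x : ℝ) ≤ Real.log (2 * ((x : ℝ) - d)) :=
      Real.log_le_log hx0 (by linarith)
    rw [Real.log_mul (by norm_num) (by linarith)] at h1
    have h2 : Real.log 2 ≤ Real.log ((x : ℝ) - d) := Real.log_le_log (by norm_num) hy2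
    linarith
  have hcmp : Real.log ((x : ℝ) - d) ^ t ≤ (2 : ℝ) ^ (R + 1) * Real.log (x : ℝ) ^ t :=
    rpow_le_two_rpow_mul hlog0 hlogy hcmp1 hcmp2 ht1 ht2
  have hbig : ‖∑ m ∈ range (x - d + 1), z ^ g m‖ ≤
      (2 : ℝ) ^ (R + 1) * A₁ * x * Real.log (x : ℝ) ^ t * E := by
    refine (hcell (x - d) (by omega) z hz).trans ?_
    rw [Nat.cast_sub hxd]
    calc A₁ * ((x : ℝ) - d) * Real.log ((x : ℝ) - d) ^ t * E
        = A₁ * (((x : ℝ) - d) * Real.log ((x : ℝ) - d) ^ t) * E := by ring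
      _ ≤ A₁ * ((x : ℝ) * ((2 : ℝ) ^ (R + 1) * Real.log (x : ℝ) ^ t)) * E := by
          refine mul_le_mul_of_nonneg_right (mul_le_mul_of_nonneg_left ?_ hA) (by positivity)
          exact mul_le_mul (by linarith [(Nat.cast_nonneg d : (0 : ℝ) ≤ d)]) hcmp
            (Real.rpow_nonneg hlogy.le t) hx0.le
      _ = (2 : ℝ) ^ (R + 1) * A₁ * x * Real.log (x : ℝ) ^ t * E := by ring
  calc ‖(d : ℂ) + ∑ m ∈ range (x - d + 1), z ^ g m‖
      ≤ ‖(d : ℂ)‖ + ‖∑ m ∈ range (x - d + 1), z ^ g m‖ := norm_add_le _ _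
    _ = d + ‖∑ m ∈ range (x - d + 1), z ^ g m‖ := by rw [Complex.norm_natCast]
    _ ≤ d * ((x : ℝ) * Real.log (x : ℝ) ^ t * E) +
          (2 : ℝ) ^ (R + 1) * A₁ * x * Real.log (x : ℝ) ^ t * E :=
        add_le_add (le_mul_of_one_le_right (Nat.cast_nonneg d) hone) hbig
    _ = ((2 : ℝ) ^ (R + 1) * A₁ + d) * x * Real.log (x : ℝ) ^ t * E := by ring

end FixedDiscXAdd

open FixedDiscXAdd in
/-- **Calibration (`k = 1`, `f = X + c`, fixed disc; registered stub `stub_fixedDiscXAdd`).**  For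
every `c : ℤ` and every `R₀` there are `A, C` and `x₀` such that for all `x ≥ x₀` and all `z` with
`‖z − 1‖ ≤ R₀`: `‖Σ_{0≤n≤x} z^{s((n+c)⁺)}‖ ≤ A·x·(log x)^{Re z − 1}·exp(C‖z−1‖ log(‖z−1‖+2))` — the
body of the crux `DiscMajorantLog` for EVERY monic degree-1 system `(X + c)` with the growing radius
`3 log log x` replaced by a fixed radius `R₀`.  Reduction to the landed cell `stub_fixedDiscX`
(`f = X`): index shift `n ↦ n + c`, triangle inequality, `(log(x ± d))^{t} ≤ 2^{R₀+1}(log x)^{t}`,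
constants absorbed by `x(log x)^{t} ≥ 1`. [cite: MontgomeryVaughan2007, §7.4 Theorems 7.17–7.18] -/
theorem stub_fixedDiscXAdd :
    ∀ (c : ℤ) (R₀ : ℝ), ∃ A C : ℝ, ∃ x₀ : ℕ, ∀ x : ℕ, x₀ ≤ x → ∀ z : ℂ, ‖z - 1‖ ≤ R₀ →
      ‖(∑ n ∈ Finset.range (x + 1), (z : ℂ) ^ (∑ i, ((((![Polynomial.X + Polynomial.C c] : Fin 1 → Polynomial ℤ) i).eval
          (n : ℤ)).toNat.factorization.sum fun _ v => min v 2)))‖ ≤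
        A * (x : ℝ) * (Real.log (x : ℝ)) ^ (((1 : ℕ) : ℝ) * ((z : ℂ).re - 1)) *
          Real.exp (C * ‖(z : ℂ) - 1‖ * Real.log (‖(z : ℂ) - 1‖ + 2)) := by
  intro c R₀
  obtain ⟨A₁, C₁, hA, hC, x₁, hcell⟩ := cell (max R₀ 0)
  have hR : 0 ≤ max R₀ 0 := le_max_right _ _
  obtain ⟨d, rfl | rfl⟩ := Int.eq_nat_or_neg c
  · obtain ⟨A, x₀, h⟩ :=
      case_natCast (fun m => m.factorization.sum fun _ v => min v 2) hR hA hC hcell d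
    refine ⟨A, C₁, x₀, fun x hx z hz => ?_⟩
    simp_rw [exponent_XAdd, Nat.cast_one, one_mul]
    exact h x hx z (hz.trans (le_max_left _ _))
  · obtain ⟨A, x₀, h⟩ :=
      case_neg (fun m => m.factorization.sum fun _ v => min v 2) (by simp) hA hC hcell d
    refine ⟨A, C₁, x₀, fun x hx z hz => ?_⟩
    simp_rw [exponent_XAdd, Nat.cast_one, one_mul]
    exact h x hx z (hz.trans (le_max_left _ _))

end Summit.Parity.BatemanHorn.Cruxes.DiscMajorantLog.Sketch

end
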